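import Mathlib
import Literature.Topology.FourManifolds.HomotopySpheres

/-!
# Crease ladder — the typed split of the crux `CreaseCollapse` (stmt-SmoothPoincare4-7481), FRAME FORM

Crux-strategist decomposition (BC2 redirect) of the deciding crux
`Summit.SmoothPoincare4.SmoothPoincare4.Theses.EuclideanOrigami.CreaseCollapse` of route
SmoothPoincare4/EuclideanOrigami ("every fake ball `Δ_e = S ∖ e(B̊⁴)` of a homotopy 4-sphere admits an
immersion `F` into `ℝ⁴` whose crease `F ∘ e|S³` has no triple points") into the three rungs of the route's
own CREASE LADDER (route header, TWO-LAYER PLAN / NOT DECOMPOSED YET: the crease complexity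
`c(Δ) = (#quadruple values, #components of the triple-value set)` minimised over immersed fake balls):

* `TameCrease` (support, known in print — Hirsch–Poenaru–Phillips existence + multijet transversality):
  for every `S`, `e` SOME immersed fake ball has a crease with finitely many quadruple values and finitely
  many connected components of its triple-value set;
* `QuadrupleCancellation` (crux, rung 4 → 3): an immersed fake ball with such a TAME crease having a
  quadruple value can be traded (same `S`, same chart `e`) for one with a tame crease and FEWER quadruple
  values;
* `TripleCircleElimination` (crux, rung 3 → 2): an immersed fake ball with quadruple-free crease whose
  triple-value set has finitely many components, one of them non-empty, can be traded for one with
  quadruple-free crease and FEWER triple-value components.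

This file is the ASSEMBLY `creaseCollapse_of_pieces : ⟦TameCrease⟧ → ⟦QuadrupleCancellation⟧ →
⟦TripleCircleElimination⟧ → ⟦CreaseCollapse⟧` with all four bodies written out verbatim (the children
exactly as filed in `children.json`; the conclusion is character-for-character the body of the route decl
`CreaseCollapse`, rev 4). It deliberately does NOT import the route module, so that the route file can import
this module and the gate-rendered link
`theorem CreaseCollapseGlueBy_holds : TameCrease → QuadrupleCancellation → TripleCircleElimination →
CreaseCollapse := _root_.….creaseCollapse_of_pieces` typechecks by δ-unfolding (rehearsed in
`Cruxes/CreaseCollapse/SeamByName.lean`, which also proves the by-name form against the route decl and the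
positioning theorems `CreaseCollapse → each piece`). Landable verbatim (up to the namespace line) as
`Summits/SmoothPoincare4/SmoothPoincare4/Theorems/EuclideanOrigamiCreaseCollapseSplit.lean` by any prover
(`--supports stmt-SmoothPoincare4-7481`; a planner's propose is refused `perm.theorems-prover-only`).

PROOF (35 tactic lines, axioms `propext`, `Classical.choice`, `Quot.sound`): fix `(S, e)`; name the
immersion clause `Imm F`, the quadruple-value set `Q F`, the triple-value set `T F` and its component set
`K F`; specialise the three pieces; STAGE 1 = well-founded descent on `(Q F).ncard` from the tame `F₀` of
`TameCrease` through `QuadrupleCancellation` to an immersed fake ball with `Q F = ∅` and `K F` finite;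
STAGE 2 = well-founded descent on `(K F).ncard` through `TripleCircleElimination` to `T F = ∅`; finally
`T F = ∅` is unpacked into the route's "no triple points" clause
(`F (e u) = F (e v) = F (e w)` with unit `u v w` forces a coincidence).

LOGICAL SHAPE (stated plainly, see DECOMPOSITION.md §4): per `(S, e)` the two step pieces are equivalent to
the rung implications `C₄ → C₃` and `C₃ → C₂` between the EXISTENCE statements `C₄` (a tame immersed fake
ball exists), `C₃` (a tame quadruple-free one exists), `C₂ = CreaseCollapse (S, e)`; the cut passes through
the intermediate rung `C₃`, an object neither the summit nor the crux mentions. The one-defect-at-a-time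
form filed here is the form the registered skeletons attack (cancel a PAIR of quadruple points; eliminate ONE
triple circle) and makes the monotone complexity explicit in the item signatures.
-/

set_option linter.dupNamespace false

namespace Summit.SmoothPoincare4.SmoothPoincare4.Cruxes.CreaseCollapse.LadderSplit

open scoped Manifold ContDiff Topology
open Set Function

/-- **Crease ladder, frame form.** `⟦TameCrease⟧ → ⟦QuadrupleCancellation⟧ → ⟦TripleCircleElimination⟧ →
⟦CreaseCollapse⟧`, every body verbatim (children.json / route decl `EuclideanOrigami.CreaseCollapse`). -/
theorem creaseCollapse_of_pieces :
    (∀ (S : Literature.Topology.FourManifolds.HomotopySphere 4) (e : EuclideanSpace ℝ (Fin 4) → S.carrier), Manifold.IsSmoothEmbedding (𝓡 4) (𝓡 4) ∞ e → ∃ F : S.carrier → EuclideanSpace ℝ (Fin 4), (∀ x, x ∉ e '' Metric.ball (0 : EuclideanSpace ℝ (Fin 4)) 1 → IsLocalDiffeomorphAt (𝓡 4) (𝓡 4) ∞ F x) ∧ {y : EuclideanSpace ℝ (Fin 4) | ∃ a b c d : EuclideanSpace ℝ (Fin 4), ‖a‖ = 1 ∧ ‖b‖ = 1 ∧ ‖c‖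 = 1 ∧ ‖d‖ = 1 ∧ a ≠ b ∧ a ≠ c ∧ a ≠ d ∧ b ≠ c ∧ b ≠ d ∧ c ≠ d ∧ F (e a) = y ∧ F (e b) = y ∧ F (e c) = y ∧ F (e d) = y}.Finite ∧ ((fun y => connectedComponentIn {y : EuclideanSpace ℝ (Fin 4) | ∃ u v w : EuclideanSpace ℝ (Fin 4), ‖u‖ = 1 ∧ ‖v‖ = 1 ∧ ‖w‖ = 1 ∧ u ≠ v ∧ v ≠ w ∧ u ≠ w ∧ F (e u) = y ∧ F (e v) = y ∧ F (e w) = y} y) '' {y : EuclideanSpace ℝ (Fin 4) | ∃ u v w : EuclideanSpace ℝ (Fin 4), ‖u‖ = 1 ∧ ‖v‖ = 1 ∧ ‖w‖ = 1 ∧ u ≠ v ∧ v ≠ w ∧ u ≠ w ∧ F (e u) = y ∧ F (e v) = y ∧ F (e w) = y}).Finite) →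
    (∀ (S : Literature.Topology.FourManifolds.HomotopySphere 4) (e : EuclideanSpace ℝ (Fin 4) → S.carrier) (F : S.carrier → EuclideanSpace ℝ (Fin 4)), Manifold.IsSmoothEmbedding (𝓡 4) (𝓡 4) ∞ e → (∀ x, x ∉ e '' Metric.ball (0 : EuclideanSpace ℝ (Fin 4)) 1 → IsLocalDiffeomorphAt (𝓡 4) (𝓡 4) ∞ F x) → {y : EuclideanSpace ℝ (Fin 4) | ∃ a b c d : EuclideanSpace ℝ (Fin 4), ‖a‖ = 1 ∧ ‖b‖ = 1 ∧ ‖c‖ = 1 ∧ ‖d‖ = 1 ∧ a ≠ b ∧ a ≠ c ∧ a ≠ d ∧ b ≠ c ∧ b ≠ d ∧ c ≠ d ∧ F (e a) = y ∧ F (e b) = y ∧ F (e c) = y ∧ F (e d) = y}.Finite → {y : EuclideanSpace ℝ (Fin 4) | ∃ a b c d : EuclideanSpace ℝ (Fin 4), ‖a‖ = 1 ∧ ‖b‖ = 1 ∧ ‖c‖ = 1 ∧ ‖d‖ = 1 ∧ a ≠ b ∧ a ≠ c ∧ a ≠ d ∧ b ≠ c ∧ b ≠ d ∧ c ≠ d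 ∧ F (e a) = y ∧ F (e b) = y ∧ F (e c) = y ∧ F (e d) = y}.Nonempty → ((fun y => connectedComponentIn {y : EuclideanSpace ℝ (Fin 4) | ∃ u v w : EuclideanSpace ℝ (Fin 4), ‖u‖ = 1 ∧ ‖v‖ = 1 ∧ ‖w‖ = 1 ∧ u ≠ v ∧ v ≠ w ∧ u ≠ w ∧ F (e u) = y ∧ F (e v) = y ∧ F (e w) = y} y) '' {y : EuclideanSpace ℝ (Fin 4) | ∃ u v w : EuclideanSpace ℝ (Fin 4), ‖u‖ = 1 ∧ ‖v‖ = 1 ∧ ‖w‖ = 1 ∧ u ≠ v ∧ v ≠ w ∧ u ≠ w ∧ F (e u) = y ∧ F (e v) = y ∧ F (e w) = y}).Finite → ∃ F' : S.carrier → EuclideanSpace ℝ (Fin 4), (∀ x, x ∉ e '' Metric.ball (0 : EuclideanSpace ℝ (Fin 4)) 1 → IsLocalDiffeomorphAt (𝓡 4) (𝓡 4) ∞ F' x) ∧ {y : EuclideanSpace ℝ (Fin 4) | ∃ a b c d : EuclideanSpace ℝ (Fin 4), ‖a‖ = 1 ∧ ‖b‖ = 1 ∧ ‖c‖ = 1 ∧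 ‖d‖ = 1 ∧ a ≠ b ∧ a ≠ c ∧ a ≠ d ∧ b ≠ c ∧ b ≠ d ∧ c ≠ d ∧ F' (e a) = y ∧ F' (e b) = y ∧ F' (e c) = y ∧ F' (e d) = y}.Finite ∧ {y : EuclideanSpace ℝ (Fin 4) | ∃ a b c d : EuclideanSpace ℝ (Fin 4), ‖a‖ = 1 ∧ ‖b‖ = 1 ∧ ‖c‖ = 1 ∧ ‖d‖ = 1 ∧ a ≠ b ∧ a ≠ c ∧ a ≠ d ∧ b ≠ c ∧ b ≠ d ∧ c ≠ d ∧ F' (e a) = y ∧ F' (e b) = y ∧ F' (e c) = y ∧ F' (e d) = y}.ncard < {y : EuclideanSpace ℝ (Fin 4) | ∃ a b c d : EuclideanSpace ℝ (Fin 4), ‖a‖ = 1 ∧ ‖b‖ = 1 ∧ ‖c‖ = 1 ∧ ‖d‖ = 1 ∧ a ≠ b ∧ a ≠ c ∧ a ≠ d ∧ b ≠ c ∧ b ≠ d ∧ c ≠ d ∧ F (e a) = y ∧ F (e b) = y ∧ F (e c) = y ∧ F (e d) = y}.ncard ∧ ((fun y => connectedComponentIn {y : EuclideanSpace ℝ (Fin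 4) | ∃ u v w : EuclideanSpace ℝ (Fin 4), ‖u‖ = 1 ∧ ‖v‖ = 1 ∧ ‖w‖ = 1 ∧ u ≠ v ∧ v ≠ w ∧ u ≠ w ∧ F' (e u) = y ∧ F' (e v) = y ∧ F' (e w) = y} y) '' {y : EuclideanSpace ℝ (Fin 4) | ∃ u v w : EuclideanSpace ℝ (Fin 4), ‖u‖ = 1 ∧ ‖v‖ = 1 ∧ ‖w‖ = 1 ∧ u ≠ v ∧ v ≠ w ∧ u ≠ w ∧ F' (e u) = y ∧ F' (e v) = y ∧ F' (e w) = y}).Finite) →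
    (∀ (S : Literature.Topology.FourManifolds.HomotopySphere 4) (e : EuclideanSpace ℝ (Fin 4) → S.carrier) (F : S.carrier → EuclideanSpace ℝ (Fin 4)), Manifold.IsSmoothEmbedding (𝓡 4) (𝓡 4) ∞ e → (∀ x, x ∉ e '' Metric.ball (0 : EuclideanSpace ℝ (Fin 4)) 1 → IsLocalDiffeomorphAt (𝓡 4) (𝓡 4) ∞ F x) → {y : EuclideanSpace ℝ (Fin 4) | ∃ a b c d : EuclideanSpace ℝ (Fin 4), ‖a‖ = 1 ∧ ‖b‖ = 1 ∧ ‖c‖ = 1 ∧ ‖d‖ = 1 ∧ a ≠ b ∧ a ≠ c ∧ a ≠ d ∧ b ≠ c ∧ b ≠ d ∧ c ≠ d ∧ F (e a) = y ∧ F (e b) = y ∧ F (e c) = y ∧ F (e d) = y} = ∅ → ((fun y => connectedComponentIn {y : EuclideanSpace ℝ (Fin 4) | ∃ u v w : EuclideanSpace ℝ (Fin 4), ‖u‖ = 1 ∧ ‖v‖ = 1 ∧ ‖w‖ = 1 ∧ u ≠ v ∧ v ≠ w ∧ u ≠ w ∧ F (e u) = y ∧ F (e v) = y ∧ F (e w)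 = y} y) '' {y : EuclideanSpace ℝ (Fin 4) | ∃ u v w : EuclideanSpace ℝ (Fin 4), ‖u‖ = 1 ∧ ‖v‖ = 1 ∧ ‖w‖ = 1 ∧ u ≠ v ∧ v ≠ w ∧ u ≠ w ∧ F (e u) = y ∧ F (e v) = y ∧ F (e w) = y}).Finite → {y : EuclideanSpace ℝ (Fin 4) | ∃ u v w : EuclideanSpace ℝ (Fin 4), ‖u‖ = 1 ∧ ‖v‖ = 1 ∧ ‖w‖ = 1 ∧ u ≠ v ∧ v ≠ w ∧ u ≠ w ∧ F (e u) = y ∧ F (e v) = y ∧ F (e w) = y}.Nonempty → ∃ F' : S.carrier → EuclideanSpace ℝ (Fin 4), (∀ x, x ∉ e '' Metric.ball (0 : EuclideanSpace ℝ (Fin 4)) 1 → IsLocalDiffeomorphAt (𝓡 4) (𝓡 4) ∞ F' x) ∧ {y : EuclideanSpace ℝ (Fin 4) | ∃ a b c d : EuclideanSpace ℝ (Fin 4), ‖a‖ = 1 ∧ ‖b‖ = 1 ∧ ‖c‖ = 1 ∧ ‖d‖ = 1 ∧ a ≠ b ∧ a ≠ c ∧ a ≠ d ∧ b ≠ c ∧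 b ≠ d ∧ c ≠ d ∧ F' (e a) = y ∧ F' (e b) = y ∧ F' (e c) = y ∧ F' (e d) = y} = ∅ ∧ ((fun y => connectedComponentIn {y : EuclideanSpace ℝ (Fin 4) | ∃ u v w : EuclideanSpace ℝ (Fin 4), ‖u‖ = 1 ∧ ‖v‖ = 1 ∧ ‖w‖ = 1 ∧ u ≠ v ∧ v ≠ w ∧ u ≠ w ∧ F' (e u) = y ∧ F' (e v) = y ∧ F' (e w) = y} y) '' {y : EuclideanSpace ℝ (Fin 4) | ∃ u v w : EuclideanSpace ℝ (Fin 4), ‖u‖ = 1 ∧ ‖v‖ = 1 ∧ ‖w‖ = 1 ∧ u ≠ v ∧ v ≠ w ∧ u ≠ w ∧ F' (e u) = y ∧ F' (e v) = y ∧ F' (e w) = y}).Finite ∧ ((fun y => connectedComponentIn {y : EuclideanSpace ℝ (Fin 4) | ∃ u v w : EuclideanSpace ℝ (Fin 4), ‖u‖ = 1 ∧ ‖v‖ = 1 ∧ ‖w‖ = 1 ∧ u ≠ v ∧ v ≠ w ∧ u ≠ w ∧ F' (e u) = y ∧ F' (e v) = y ∧ F' (e w) = y} y) '' {y : EuclideanSpace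 ℝ (Fin 4) | ∃ u v w : EuclideanSpace ℝ (Fin 4), ‖u‖ = 1 ∧ ‖v‖ = 1 ∧ ‖w‖ = 1 ∧ u ≠ v ∧ v ≠ w ∧ u ≠ w ∧ F' (e u) = y ∧ F' (e v) = y ∧ F' (e w) = y}).ncard < ((fun y => connectedComponentIn {y : EuclideanSpace ℝ (Fin 4) | ∃ u v w : EuclideanSpace ℝ (Fin 4), ‖u‖ = 1 ∧ ‖v‖ = 1 ∧ ‖w‖ = 1 ∧ u ≠ v ∧ v ≠ w ∧ u ≠ w ∧ F (e u) = y ∧ F (e v) = y ∧ F (e w) = y} y) '' {y : EuclideanSpace ℝ (Fin 4) | ∃ u v w : EuclideanSpace ℝ (Fin 4), ‖u‖ = 1 ∧ ‖v‖ = 1 ∧ ‖w‖ = 1 ∧ u ≠ v ∧ v ≠ w ∧ u ≠ w ∧ F (e u) = y ∧ F (e v) = y ∧ F (e w) = y}).ncard) →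
    (∀ (S : Literature.Topology.FourManifolds.HomotopySphere 4) (e : EuclideanSpace ℝ (Fin 4) → S.carrier), Manifold.IsSmoothEmbedding (𝓡 4) (𝓡 4) ∞ e → ∃ F : S.carrier → EuclideanSpace ℝ (Fin 4), (∀ x, x ∉ e '' Metric.ball (0 : EuclideanSpace ℝ (Fin 4)) 1 → IsLocalDiffeomorphAt (𝓡 4) (𝓡 4) ∞ F x) ∧ ∀ u v w : EuclideanSpace ℝ (Fin 4), ‖u‖ = 1 → ‖v‖ = 1 → ‖w‖ = 1 → F (e u) = F (e v) → F (e v) = F (e w) → u = v ∨ v = w ∨ u = w) := by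
  intro hT hQ hE S e he
  -- the four functionals of an immersed fake ball `F` (for the fixed chart `e`)
  let Imm : (S.carrier → EuclideanSpace ℝ (Fin 4)) → Prop := fun F =>
    ∀ x, x ∉ e '' Metric.ball (0 : EuclideanSpace ℝ (Fin 4)) 1 → IsLocalDiffeomorphAt (𝓡 4) (𝓡 4) ∞ F x
  let Q : (S.carrier → EuclideanSpace ℝ (Fin 4)) → Set (EuclideanSpace ℝ (Fin 4)) := fun F =>
    {y : EuclideanSpace ℝ (Fin 4) | ∃ a b c d : EuclideanSpace ℝ (Fin 4), ‖a‖ = 1 ∧ ‖b‖ = 1 ∧ ‖c‖ = 1 ∧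
      ‖d‖ = 1 ∧ a ≠ b ∧ a ≠ c ∧ a ≠ d ∧ b ≠ c ∧ b ≠ d ∧ c ≠ d ∧ F (e a) = y ∧ F (e b) = y ∧
      F (e c) = y ∧ F (e d) = y}
  let T : (S.carrier → EuclideanSpace ℝ (Fin 4)) → Set (EuclideanSpace ℝ (Fin 4)) := fun F =>
    {y : EuclideanSpace ℝ (Fin 4) | ∃ u v w : EuclideanSpace ℝ (Fin 4), ‖u‖ = 1 ∧ ‖v‖ = 1 ∧ ‖w‖ = 1 ∧
      u ≠ v ∧ v ≠ w ∧ u ≠ w ∧ F (e u) = y ∧ F (e v) = y ∧ F (e w) = y}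
  let K : (S.carrier → EuclideanSpace ℝ (Fin 4)) → Set (Set (EuclideanSpace ℝ (Fin 4))) := fun F =>
    (fun y => connectedComponentIn (T F) y) '' (T F)
  -- the three pieces, specialised to `(S, e)`
  have hT' : ∃ F, Imm F ∧ (Q F).Finite ∧ (K F).Finite := hT S e he
  have hQ' : ∀ F, Imm F → (Q F).Finite → (Q F).Nonempty → (K F).Finite →
      ∃ F', Imm F' ∧ (Q F').Finite ∧ (Q F').ncard < (Q F).ncard ∧ (K F').Finite :=
    fun F => hQ S e F he
  have hE' : ∀ F, Imm F → Q F = ∅ → (K F).Finite → (T F).Nonempty →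
      ∃ F', Imm F' ∧ Q F' = ∅ ∧ (K F').Finite ∧ (K F').ncard < (K F).ncard :=
    fun F => hE S e F he
  -- rung 4 → 3: well-founded descent on the number of quadruple values
  have stage₁ : ∃ F, Imm F ∧ Q F = ∅ ∧ (K F).Finite := by
    obtain ⟨F₀, h₀, hq₀, hk₀⟩ := hT'
    suffices H : ∀ (n : ℕ) (F : S.carrier → EuclideanSpace ℝ (Fin 4)), Imm F → (Q F).Finite →
        (K F).Finite → (Q F).ncard = n → ∃ F', Imm F' ∧ Q F' = ∅ ∧ (K F').Finite from
      H _ F₀ h₀ hq₀ hk₀ rfl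
    intro n
    induction n using Nat.strong_induction_on with
    | _ n ih =>
      intro F hF hq hk hn
      rcases (Q F).eq_empty_or_nonempty with hQe | hQne
      · exact ⟨F, hF, hQe, hk⟩
      · obtain ⟨F', hF', hq', hlt, hk'⟩ := hQ' F hF hq hQne hk
        exact ih _ (hn ▸ hlt) F' hF' hq' hk' rfl
  -- rung 3 → 2: well-founded descent on the number of triple-value components
  have stage₂ : ∃ F, Imm F ∧ T F = ∅ := by
    obtain ⟨F₀, h₀, hq₀, hk₀⟩ := stage₁
    suffices H : ∀ (n : ℕ) (F : S.carrier → EuclideanSpace ℝ (Fin 4)), Imm F → Q F = ∅ →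
        (K F).Finite → (K F).ncard = n → ∃ F', Imm F' ∧ T F' = ∅ from H _ F₀ h₀ hq₀ hk₀ rfl
    intro n
    induction n using Nat.strong_induction_on with
    | _ n ih =>
      intro F hF hq hk hn
      rcases (T F).eq_empty_or_nonempty with hTe | hTne
      · exact ⟨F, hF, hTe⟩
      · obtain ⟨F', hF', hq', hk', hlt⟩ := hE' F hF hq hk hTne
        exact ih _ (hn ▸ hlt) F' hF' hq' hk' rfl
  -- an empty triple-value set is the "no triple points" clause of `CreaseCollapse`
  obtain ⟨F, hF, hTF⟩ := stage₂
  refine ⟨F, hF, ?_⟩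
  intro u v w hu hv hw h₁ h₂
  by_contra hne
  push Not at hne
  have hmem : F (e u) ∈ T F :=
    ⟨u, v, w, hu, hv, hw, hne.1, hne.2.1, hne.2.2, rfl, h₁.symm, (h₁.trans h₂).symm⟩
  rw [hTF] at hmem
  exact hmem

end Summit.SmoothPoincare4.SmoothPoincare4.Cruxes.CreaseCollapse.LadderSplit
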